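import Mathlib
import Literature.LinearAlgebra.Matrix.MoorePenroseInverse
import Literature.LinearAlgebra.Matrix.ConvergentMatrix
import HarnessLib

/-!
# Iterative (hyperpower) methods for the Moore–Penrose inverse

[Ben-Israel–Greville 2003, Ch. 7 §7 "Iterative methods for computing `A†`"] studies, for
`A ∈ ℂ^{m×n}` and an initial approximation `X₀ ∈ ℂ^{n×m}`, the *first-order method*

  `X_{k+1} = X_k + X₀ (I − A X_k)`                                            (77)

and, for an integer `p ≥ 2`, the *`p`-th order (hyperpower) method*

  `X_{k+1} = X_k (I + T_k + T_k² + ⋯ + T_k^{p−1})`,   `T_k = I − A X_k`,      (84), (73)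

whose case `p = 2` is the Schulz–Ben-Israel–Cohen iteration `X_{k+1} = X_k (2I − A X_k)`
[Ch. 7 Ex. 22, (101)].  With `P = P_{R(A)} = A A†` and the residuals `R_k = P − A X_k` (72),
Theorem 3 says: if `X₀ ∈ R(A*, A*)`, i.e. `X₀ = A* B A*` (75), (70), and `ρ(P − A X₀) < 1` (76),
then (77) converges to `A†`, with `R_{k+1} = R₀ R_k` (81) and `X_k = X₀ Σ_{i ≤ k} R₀^i` (83);
Theorem 4 says the same for (84), with `X_{k+1} = X_k (I + R_k + ⋯ + R_k^{p−1})` (87) and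
`R_{k+1} = R_k^p` (89); Theorem 5 says the `p`-th order iterate `X̃_j` equals the first-order
iterate `X_{p^j − 1}` (90), (91); Ex. 18 gives `A† = X₀ (I − R₀)⁻¹` (92); Ex. 17 is the example
showing that condition (75) cannot be dropped.

This file machine-checks that section.

* **Part I (any ring, rectangular `A`).** The residual algebra in `T`-form, with no hypothesis
  on `X₀` at all: one step of (77) multiplies `T_k = I − A X_k` by `T₀` on the left, one step
  of (84) replaces `T_k` by `T_k^p` (a geometric-sum identity), hence `T_k = T₀^{k+1}`, resp.
  `T_k = T₀^{p^k}`, and the closed forms `X_k = X₀ Σ_{i<k+1} T₀^i`, resp. `X₀ Σ_{i<p^k} T₀^i`,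
  which give Theorem 5 (90)–(91) and the product form (105) `Σ_{i<2^q} T^i = Π_{j<q} (I+T^{2^j})`.
  Then, for an abstract idempotent `P` with `P A = A` and `X₀ P = X₀` (the content of (70),
  (75)), the `R`-forms (71), (81), (83), (87), (89), (91) exactly as printed.
* **Part II (`RCLike` scalars, `P = A A†`).** `X₀ = A* B A*` implies `X₀ P = X₀` and
  `A† A X₀ = X₀`; Ch. 3 Ex. 19: a `{1}`-inverse lying in `R(A*, A*)` is `A†`, and `A†` lies there;
  and the algebraic identity `A† (I − R₀) = X₀` behind Ex. 18 (92).
* **Part III (convergence).** In the (product) topology of `Matrix`, with "`R₀` is a convergent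
  matrix", i.e. `R₀^k → O` (Ch. 0 Ex. 45 (63): equivalent to `ρ(R₀) < 1`, which is (76)), as
  the hypothesis: `I − R₀` is nonsingular and `Σ_{j<k} R₀^j → (I − R₀)⁻¹` (Ex. 46 (65)); hence
  Theorem 3 (`X_k → A†`, `R_k → O` (82)), Ex. 18 (92), and Theorem 4 (convergence of (84) for
  `p ≥ 2`).  For complex matrices the hypothesis is supplied from `ρ(R₀) < 1` verbatim, using
  `Literature.LinearAlgebra.Matrix.tendsto_pow_apply_of_spectralRadius_lt_one`.
* **Part IV (Ex. 17).** The `2 × 2` example `A = ½[1 1; 1 1] = A†`, `X₀ = A + ε[1 −1; −1 1]`: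
  here `R₀ = O` (so (76) holds) but `X₀ P ≠ X₀` ((75) fails), the residual-form iterates (80),
  (87) stay at `X₀ ≠ A†`, and the `T`-form iterates of (77), resp. (101), are `A + (k+1)εB₁`,
  resp. `A + 2^k εB₁` — none of them converges to `A†`.

Remarks on the text. (i) Ex. 17 asserts "`X_k = X₀`, `k = 0, 1, …`" for (77) and (84); this is
literally true for the residual forms (80), (87), which agree with (77), (84) precisely when
`X₀ P = X₀` — the hypothesis that fails in the example; for the `T`-forms the iterates drift as
computed in Part IV.  Either way the sequence does not converge to `A†`, which is the point of the
exercise.  (ii) Ex. 21 writes the `k`-th residual of the `p`-th order method as `(P_{R(A)} −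
A X₀)^{p^{k+1}}`; by (89)–(90) it is `R₀^{p^k}` (`hyperpower_proj_sub_mul` below), consistent
with (81) and Theorem 5.  (iii) The norm estimates (78), (85), (102) are `norm_mul_le` /
`norm_pow_le` applied to (81), (89) and are not restated.
-/

namespace Literature.LinearAlgebra.Matrix.HyperpowerIteration

open Finset Filter _root_.Matrix
open scoped _root_.Topology

/-! ## Part I — residual algebra over an arbitrary ring -/

section Ring

variable {R : Type*} [Ring R] {m n : Type*} [Fintype m] [Fintype n] [DecidableEq m]

/-! ### `T`-form: no hypothesis on `X₀` -/

/-- One step of the first-order method (77) in `T`-form: `I − A X_{k+1} = (I − A X₀)(I − A X_k)`,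
the identity behind (81). [cite: BenIsraelGreville2003, Ch. 7 §7 Thm 3, proof of (81)] -/
theorem one_sub_mul_firstOrderStep (A : Matrix m n R) (X₀ Xk : Matrix n m R) :
    1 - A * (Xk + X₀ * (1 - A * Xk)) = (1 - A * X₀) * (1 - A * Xk) := by
  simp only [Matrix.mul_add, Matrix.mul_sub, Matrix.mul_one, Matrix.sub_mul, Matrix.one_mul,
    Matrix.mul_assoc]
  abel

/-- One step of the `p`-th order method (84) in `T`-form: `I − A X_k (I + T_k + ⋯ + T_k^{p−1})
= T_k^p`, the identity behind (89). [cite: BenIsraelGreville2003, Ch. 7 §7 Thm 4, proof of (89)] -/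
theorem one_sub_mul_hyperpowerStep (A : Matrix m n R) (Xk : Matrix n m R) (p : ℕ) :
    1 - A * (Xk * ∑ i ∈ range p, (1 - A * Xk) ^ i) = (1 - A * Xk) ^ p := by
  rw [← Matrix.mul_assoc]
  set T := 1 - A * Xk with hT
  have hAX : A * Xk = 1 - T := by rw [hT, sub_sub_cancel]
  rw [hAX, mul_neg_geom_sum, sub_sub_cancel]

/-- The case `p = 2` of (84) is the Schulz / Ben-Israel–Cohen iteration (101):
`X_k (I + T_k) = X_k (2I − A X_k)`. [cite: BenIsraelGreville2003, Ch. 7 Ex. 22 (101)] -/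
theorem hyperpowerStep_two (A : Matrix m n R) (Xk : Matrix n m R) :
    Xk * ∑ i ∈ range 2, (1 - A * Xk) ^ i = Xk * (2 - A * Xk) := by
  rw [sum_range_succ, sum_range_one, pow_zero, pow_one, ← one_add_one_eq_two, add_sub_assoc]

/-- One Schulz step (101) squares the residual: `I − A X_k (2I − A X_k) = (I − A X_k)²`
(the identity behind (102)). [cite: BenIsraelGreville2003, Ch. 7 Ex. 22 (101)–(102)] -/
theorem one_sub_mul_schulzStep (A : Matrix m n R) (Xk : Matrix n m R) :
    1 - A * (Xk * (2 - A * Xk)) = (1 - A * Xk) ^ 2 := by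
  rw [← hyperpowerStep_two, one_sub_mul_hyperpowerStep]

/-- Iterating projectors [Ch. 7 Ex. 24 (111)], `T`-form: one step
`Y_{k+1} = Y_k (I + T_k + ⋯ + T_k^{p−1})` with `T_k = I − Y_k` gives `I − Y_{k+1} = T_k^p`.
[cite: BenIsraelGreville2003, Ch. 7 Ex. 24 (111)] -/
theorem one_sub_projStep (Yk : Matrix m m R) (p : ℕ) :
    1 - Yk * ∑ i ∈ range p, (1 - Yk) ^ i = (1 - Yk) ^ p := by
  simpa only [Matrix.one_mul] using one_sub_mul_hyperpowerStep (1 : Matrix m m R) Yk p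

/-- First-order method (77), `T`-form of (81): `I − A X_k = (I − A X₀)^{k+1}`.
[cite: BenIsraelGreville2003, Ch. 7 §7 Thm 3 (81)] -/
theorem firstOrder_one_sub_mul (A : Matrix m n R) (X : ℕ → Matrix n m R)
    (hX : ∀ k, X (k + 1) = X k + X 0 * (1 - A * X k)) (k : ℕ) :
    1 - A * X k = (1 - A * X 0) ^ (k + 1) := by
  induction k with
  | zero => rw [zero_add, pow_one]
  | succ k ih => rw [hX, one_sub_mul_firstOrderStep, ih, ← pow_succ']

/-- First-order method (77), `T`-form of (83): `X_k = X₀ (I + T₀ + ⋯ + T₀^k)`.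
[cite: BenIsraelGreville2003, Ch. 7 §7 Thm 3 (83)] -/
theorem firstOrder_eq_mul_geom_sum (A : Matrix m n R) (X : ℕ → Matrix n m R)
    (hX : ∀ k, X (k + 1) = X k + X 0 * (1 - A * X k)) (k : ℕ) :
    X k = X 0 * ∑ i ∈ range (k + 1), (1 - A * X 0) ^ i := by
  induction k with
  | zero => rw [zero_add, sum_range_one, pow_zero, Matrix.mul_one]
  | succ k ih =>
    rw [hX, firstOrder_one_sub_mul A X hX k, ih, sum_range_succ _ (k + 1), Matrix.mul_add]

/-- `p`-th order method (84), `T`-form of (89): `I − A X_{k+1} = (I − A X_k)^p`.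
[cite: BenIsraelGreville2003, Ch. 7 §7 Thm 4 (89)] -/
theorem hyperpower_one_sub_mul_succ (A : Matrix m n R) (X : ℕ → Matrix n m R) (p : ℕ)
    (hX : ∀ k, X (k + 1) = X k * ∑ i ∈ range p, (1 - A * X k) ^ i) (k : ℕ) :
    1 - A * X (k + 1) = (1 - A * X k) ^ p := by
  rw [hX, one_sub_mul_hyperpowerStep]

/-- `p`-th order method (84): `I − A X_k = (I − A X₀)^{p^k}` (iterate (89); cf. Ex. 21).
[cite: BenIsraelGreville2003, Ch. 7 §7 Thm 4 (89) and Ex. 21] -/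
theorem hyperpower_one_sub_mul (A : Matrix m n R) (X : ℕ → Matrix n m R) (p : ℕ)
    (hX : ∀ k, X (k + 1) = X k * ∑ i ∈ range p, (1 - A * X k) ^ i) (k : ℕ) :
    1 - A * X k = (1 - A * X 0) ^ p ^ k := by
  induction k with
  | zero => rw [pow_zero, pow_one]
  | succ k ih => rw [hyperpower_one_sub_mul_succ A X p hX, ih, ← pow_mul, ← pow_succ]

/-- `(Σ_{i<a} x^i)(Σ_{j<b} (x^a)^j) = Σ_{i<ab} x^i` (splitting a geometric sum into blocks).
[folklore] -/
private theorem geom_sum_mul_geom_sum_pow {S : Type*} [Semiring S] (x : S) (a b : ℕ) :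
    (∑ i ∈ range a, x ^ i) * ∑ j ∈ range b, (x ^ a) ^ j = ∑ i ∈ range (a * b), x ^ i := by
  induction b with
  | zero => rw [sum_range_zero, mul_zero, mul_zero, sum_range_zero]
  | succ b ih =>
    rw [sum_range_succ, mul_add, ih, Nat.mul_succ, sum_range_add, ← pow_mul, sum_mul]
    refine congrArg _ (sum_congr rfl fun i _ => ?_)
    rw [← pow_add, Nat.add_comm]

/-- `p`-th order method (84), `T`-form of (91): `X_k = X₀ (I + T₀ + ⋯ + T₀^{p^k − 1})`.
[cite: BenIsraelGreville2003, Ch. 7 §7 Thm 5 (91)] -/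
theorem hyperpower_eq_mul_geom_sum (A : Matrix m n R) (X : ℕ → Matrix n m R) (p : ℕ)
    (hX : ∀ k, X (k + 1) = X k * ∑ i ∈ range p, (1 - A * X k) ^ i) (k : ℕ) :
    X k = X 0 * ∑ i ∈ range (p ^ k), (1 - A * X 0) ^ i := by
  induction k with
  | zero => rw [pow_zero, sum_range_one, pow_zero, Matrix.mul_one]
  | succ k ih =>
    rw [hX, hyperpower_one_sub_mul A X p hX k, ih, Matrix.mul_assoc, geom_sum_mul_geom_sum_pow,
      ← pow_succ]

/-- **Theorem 5** (90): the `p`-th order iterates are a subsequence of the first-order iterates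
started from the same `X₀`: `X̃_j = X_{p^j − 1}` (`p ≥ 1`; the book has `p ≥ 2`).
[cite: BenIsraelGreville2003, Ch. 7 §7 Thm 5 (90)] -/
theorem hyperpower_eq_firstOrder (A : Matrix m n R) (X Y : ℕ → Matrix n m R) {p : ℕ}
    (hp : 0 < p) (hX : ∀ k, X (k + 1) = X k + X 0 * (1 - A * X k))
    (hY : ∀ j, Y (j + 1) = Y j * ∑ i ∈ range p, (1 - A * Y j) ^ i) (hY₀ : Y 0 = X 0) (j : ℕ) :
    Y j = X (p ^ j - 1) := by
  rw [hyperpower_eq_mul_geom_sum A Y p hY j, firstOrder_eq_mul_geom_sum A X hX,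
    Nat.sub_add_cancel (Nat.one_le_pow j p hp), hY₀]

/-- Product form of the geometric sum used to implement the `2^q`-th order method with `q`
multiplications: `I + T + ⋯ + T^{2^q − 1} = Π_{j<q} (I + T^{2^j})` (eq. (105); the factors
commute, the product is written as a `List` product in increasing `j`).
[cite: BenIsraelGreville2003, Ch. 7 §7 eq. (105)] -/
theorem geom_sum_two_pow_eq_prod {S : Type*} [Semiring S] (T : S) (q : ℕ) :
    ∑ i ∈ range (2 ^ q), T ^ i = ((List.range q).map fun j => 1 + T ^ 2 ^ j).prod := by
  induction q with
  | zero => rw [pow_zero, sum_range_one, pow_zero, List.range_zero, List.map_nil, List.prod_nil]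
  | succ q ih =>
    rw [List.range_succ, List.map_append, List.prod_append, List.map_singleton,
      List.prod_singleton, ← ih, pow_succ, ← geom_sum_mul_geom_sum_pow, sum_range_succ,
      sum_range_one, pow_zero, pow_one]

/-! ### `R`-form: an idempotent `P` with `P A = A` and `X₀ P = X₀` -/

variable {P : Matrix m m R} {A : Matrix m n R}

/-- Eq. (71): `X₀ T_k = X₀ R_k` whenever `X₀ = X₀ P` (70).
[cite: BenIsraelGreville2003, Ch. 7 §7 (70)–(71)] -/
theorem mul_one_sub_eq_mul_proj_sub {X₀ : Matrix n m R} (hX₀ : X₀ * P = X₀) (Xk : Matrix n m R) :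
    X₀ * (1 - A * Xk) = X₀ * (P - A * Xk) := by
  rw [Matrix.mul_sub, Matrix.mul_sub, Matrix.mul_one, hX₀]

/-- `P T_k = R_k` when `P A = A` (`P = P_{R(A)}`). [cite: BenIsraelGreville2003, Ch. 7 §7 Thm 3,
proof ("`P_{R(A)} A = A`")] -/
theorem proj_mul_one_sub (hPA : P * A = A) (Xk : Matrix n m R) :
    P * (1 - A * Xk) = P - A * Xk := by
  rw [Matrix.mul_sub, Matrix.mul_one, ← Matrix.mul_assoc, hPA]

/-- `T_k P = R_k` when `X_k P = X_k` (which holds along the iteration, `firstOrder_mul_proj`).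
[cite: BenIsraelGreville2003, Ch. 7 §7 Thm 3, proof] -/
theorem one_sub_mul_proj {Xk : Matrix n m R} (hXk : Xk * P = Xk) :
    (1 - A * Xk) * P = P - A * Xk := by
  rw [Matrix.sub_mul, Matrix.one_mul, Matrix.mul_assoc, hXk]

/-- `P` commutes with `T_k` under `P A = A`, `X_k P = X_k`. [folklore] -/
private theorem commute_proj_one_sub (hPA : P * A = A) {Xk : Matrix n m R} (hXk : Xk * P = Xk) :
    Commute P (1 - A * Xk) :=
  show P * (1 - A * Xk) = (1 - A * Xk) * P by rw [proj_mul_one_sub hPA, one_sub_mul_proj hXk]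

/-- The conversion between the two residuals: `P T_k^{i+1} = R_k^{i+1}` for an idempotent `P`
with `P A = A`, `X_k P = X_k`. [cite: BenIsraelGreville2003, Ch. 7 §7 Thm 3, proof of (81)] -/
theorem proj_mul_one_sub_pow (hP : P * P = P) (hPA : P * A = A) {Xk : Matrix n m R}
    (hXk : Xk * P = Xk) (i : ℕ) : P * (1 - A * Xk) ^ (i + 1) = (P - A * Xk) ^ (i + 1) := by
  rw [← proj_mul_one_sub hPA Xk, (commute_proj_one_sub hPA hXk).mul_pow,
    (show IsIdempotentElem P from hP).pow_succ_eq]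

/-- `X_k T_k^i = X_k R_k^i` (the step from (84) to (87)).
[cite: BenIsraelGreville2003, Ch. 7 §7 Thm 4, proof of (87)] -/
theorem mul_one_sub_pow (hP : P * P = P) (hPA : P * A = A) {Xk : Matrix n m R}
    (hXk : Xk * P = Xk) (i : ℕ) : Xk * (1 - A * Xk) ^ i = Xk * (P - A * Xk) ^ i := by
  cases i with
  | zero => rw [pow_zero, pow_zero]
  | succ i => rw [← proj_mul_one_sub_pow hP hPA hXk, ← Matrix.mul_assoc, hXk]

/-- `X_k Σ_{i<N} T_k^i = X_k Σ_{i<N} R_k^i`. [cite: BenIsraelGreville2003, Ch. 7 §7 Thm 4 (87)] -/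
theorem mul_geom_sum_one_sub (hP : P * P = P) (hPA : P * A = A) {Xk : Matrix n m R}
    (hXk : Xk * P = Xk) (N : ℕ) :
    Xk * ∑ i ∈ range N, (1 - A * Xk) ^ i = Xk * ∑ i ∈ range N, (P - A * Xk) ^ i := by
  rw [Matrix.mul_sum, Matrix.mul_sum]
  exact sum_congr rfl fun i _ => mul_one_sub_pow hP hPA hXk i

/-- Along the first-order method all iterates satisfy `X_k P = X_k` (in the book: "all `X_k` lie
in `R(A*, A*)`"). [cite: BenIsraelGreville2003, Ch. 7 §7 Thm 3, proof] -/
theorem firstOrder_mul_proj (hPA : P * A = A) {X : ℕ → Matrix n m R} (hX₀ : X 0 * P = X 0)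
    (hX : ∀ k, X (k + 1) = X k + X 0 * (1 - A * X k)) (k : ℕ) : X k * P = X k := by
  induction k with
  | zero => exact hX₀
  | succ k ih =>
    rw [hX, Matrix.add_mul, ih, Matrix.mul_assoc, one_sub_mul_proj ih, ← proj_mul_one_sub hPA (X k),
      ← Matrix.mul_assoc, hX₀]

/-- `X_k P = X_k` along the `p`-th order method (the analogue of (79) used for (87)).
[cite: BenIsraelGreville2003, Ch. 7 §7 Thm 4, proof] -/
theorem hyperpower_mul_proj (hPA : P * A = A) {X : ℕ → Matrix n m R} (hX₀ : X 0 * P = X 0)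
    {p : ℕ} (hX : ∀ k, X (k + 1) = X k * ∑ i ∈ range p, (1 - A * X k) ^ i) (k : ℕ) :
    X k * P = X k := by
  induction k with
  | zero => exact hX₀
  | succ k ih =>
    have hc : Commute P (∑ i ∈ range p, (1 - A * X k) ^ i) :=
      Commute.sum_right _ _ _ fun i _ => (commute_proj_one_sub hPA ih).pow_right i
    rw [hX, Matrix.mul_assoc, ← hc.eq, ← Matrix.mul_assoc, ih]

/-- **Theorem 3, (81)**: `R_k = P − A X_k = R₀^{k+1}`, i.e. `R_{k+1} = R₀ R_k`, for the
first-order method with `P` idempotent, `P A = A`, `X₀ P = X₀`.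
[cite: BenIsraelGreville2003, Ch. 7 §7 Thm 3 (81)] -/
theorem firstOrder_proj_sub_mul (hP : P * P = P) (hPA : P * A = A) {X : ℕ → Matrix n m R}
    (hX₀ : X 0 * P = X 0) (hX : ∀ k, X (k + 1) = X k + X 0 * (1 - A * X k)) (k : ℕ) :
    P - A * X k = (P - A * X 0) ^ (k + 1) := by
  rw [← proj_mul_one_sub hPA, firstOrder_one_sub_mul A X hX k, proj_mul_one_sub_pow hP hPA hX₀]

/-- **Theorem 3, (80) = (77)**: under (70) the first-order step may be written with either
residual, `X_k + X₀ T_k = X_k + X₀ R_k`. [cite: BenIsraelGreville2003, Ch. 7 §7 Thm 3 (80)] -/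
theorem firstOrder_succ_eq_proj {X₀ : Matrix n m R} (hX₀ : X₀ * P = X₀) {X : ℕ → Matrix n m R}
    (hX0 : X 0 = X₀) (hX : ∀ k, X (k + 1) = X k + X 0 * (1 - A * X k)) (k : ℕ) :
    X (k + 1) = X k + X 0 * (P - A * X k) := by
  rw [hX, hX0, mul_one_sub_eq_mul_proj_sub hX₀]

/-- **Theorem 3, (83)**: `X_k = X₀ (I + R₀ + R₀² + ⋯ + R₀^k)`.
[cite: BenIsraelGreville2003, Ch. 7 §7 Thm 3 (83)] -/
theorem firstOrder_eq_mul_geom_sum_proj (hP : P * P = P) (hPA : P * A = A)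
    {X : ℕ → Matrix n m R} (hX₀ : X 0 * P = X 0)
    (hX : ∀ k, X (k + 1) = X k + X 0 * (1 - A * X k)) (k : ℕ) :
    X k = X 0 * ∑ i ∈ range (k + 1), (P - A * X 0) ^ i := by
  rw [firstOrder_eq_mul_geom_sum A X hX k, mul_geom_sum_one_sub hP hPA hX₀]

/-- **Theorem 4, (87)**: `X_{k+1} = X_k (I + R_k + ⋯ + R_k^{p−1})`.
[cite: BenIsraelGreville2003, Ch. 7 §7 Thm 4 (87)] -/
theorem hyperpower_succ_eq_mul_geom_sum_proj (hP : P * P = P) (hPA : P * A = A)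
    {X : ℕ → Matrix n m R} (hX₀ : X 0 * P = X 0) {p : ℕ}
    (hX : ∀ k, X (k + 1) = X k * ∑ i ∈ range p, (1 - A * X k) ^ i) (k : ℕ) :
    X (k + 1) = X k * ∑ i ∈ range p, (P - A * X k) ^ i := by
  rw [hX, mul_geom_sum_one_sub hP hPA (hyperpower_mul_proj hPA hX₀ hX k)]

/-- **Theorem 4, (89)**: `R_{k+1} = R_k^p` (`p ≥ 1`).
[cite: BenIsraelGreville2003, Ch. 7 §7 Thm 4 (89)] -/
theorem hyperpower_proj_sub_mul_succ (hP : P * P = P) (hPA : P * A = A)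
    {X : ℕ → Matrix n m R} (hX₀ : X 0 * P = X 0) {p : ℕ} (hp : 0 < p)
    (hX : ∀ k, X (k + 1) = X k * ∑ i ∈ range p, (1 - A * X k) ^ i) (k : ℕ) :
    P - A * X (k + 1) = (P - A * X k) ^ p := by
  obtain ⟨q, rfl⟩ := Nat.exists_eq_add_one_of_ne_zero hp.ne'
  rw [← proj_mul_one_sub hPA, hyperpower_one_sub_mul_succ A X (q + 1) hX k,
    proj_mul_one_sub_pow hP hPA (hyperpower_mul_proj hPA hX₀ hX k)]

/-- **Theorem 4 / Ex. 21**: the `k`-th residual of the `p`-th order method is `R₀^{p^k}`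
(`p ≥ 1`). [cite: BenIsraelGreville2003, Ch. 7 §7 Thm 4 (89), Thm 5 (90), Ex. 21] -/
theorem hyperpower_proj_sub_mul (hP : P * P = P) (hPA : P * A = A)
    {X : ℕ → Matrix n m R} (hX₀ : X 0 * P = X 0) {p : ℕ} (hp : 0 < p)
    (hX : ∀ k, X (k + 1) = X k * ∑ i ∈ range p, (1 - A * X k) ^ i) (k : ℕ) :
    P - A * X k = (P - A * X 0) ^ p ^ k := by
  obtain ⟨e, he⟩ := Nat.exists_eq_add_one_of_ne_zero (pow_pos hp k).ne'
  rw [← proj_mul_one_sub hPA, hyperpower_one_sub_mul A X p hX k, he,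
    proj_mul_one_sub_pow hP hPA hX₀]

/-- **Theorem 5, (91)**: `X̃_k = X₀ (I + R₀ + ⋯ + R₀^{p^k − 1})` for the `p`-th order method.
[cite: BenIsraelGreville2003, Ch. 7 §7 Thm 5 (91)] -/
theorem hyperpower_eq_mul_geom_sum_proj (hP : P * P = P) (hPA : P * A = A)
    {X : ℕ → Matrix n m R} (hX₀ : X 0 * P = X 0) {p : ℕ}
    (hX : ∀ k, X (k + 1) = X k * ∑ i ∈ range p, (1 - A * X k) ^ i) (k : ℕ) :
    X k = X 0 * ∑ i ∈ range (p ^ k), (P - A * X 0) ^ i := by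
  rw [hyperpower_eq_mul_geom_sum A X p hX k, mul_geom_sum_one_sub hP hPA hX₀]

end Ring

/-! ## Part II — `RCLike` scalars, `P = P_{R(A)} = A A†` -/

section MoorePenrose

open Literature.LinearAlgebra.Matrix.MoorePenrose

variable {𝕜 : Type*} [RCLike 𝕜] {m n : Type*} [Fintype m] [Fintype n] [DecidableEq n]

/-- (75) ⇒ (70): `X₀ = A* B A*` implies `X₀ P_{R(A)} = X₀` with `P_{R(A)} = A A†`.
[cite: BenIsraelGreville2003, Ch. 7 §7 Thm 3, proof ((75) implies (70))] -/
theorem conjTranspose_mul_mul_conjTranspose_mul_proj (A B : Matrix m n 𝕜) :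
    Aᴴ * B * Aᴴ * (A * pinv A) = Aᴴ * B * Aᴴ := by
  rw [Matrix.mul_assoc, conjTranspose_mul_mul_pinv]

/-- Dually, `X₀ = A* B A*` implies `A† A X₀ = X₀` (`R(X₀) ⊆ R(A*) = R(A† A)`).
[cite: BenIsraelGreville2003, Ch. 7 §7 Thm 3, proof; Ch. 3 Ex. 15] -/
theorem proj_mul_conjTranspose_mul_mul_conjTranspose (A B : Matrix m n 𝕜) :
    pinv A * A * (Aᴴ * B * Aᴴ) = Aᴴ * B * Aᴴ := by
  rw [Matrix.mul_assoc Aᴴ, ← Matrix.mul_assoc (pinv A * A), pinv_mul_self_mul_conjTranspose]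

/-- **Ch. 3 Ex. 19**, (a) ⇒ (b): `A†` lies in `R(A*, A*) = {A* Y A*}` (Ch. 3 Ex. 15), explicitly
`A† = A* (A†* A† A†*) A*`. [cite: BenIsraelGreville2003, Ch. 3 Ex. 19 (proof), Ex. 15] -/
theorem pinv_eq_conjTranspose_mul_mul_conjTranspose (A : Matrix m n 𝕜) :
    pinv A = Aᴴ * ((pinv A)ᴴ * pinv A * (pinv A)ᴴ) * Aᴴ := by
  have h1 : pinv A = Aᴴ * (pinv A)ᴴ * pinv A := by
    conv_lhs => rw [← pinv_mul_self_mul_pinv A, ← (isHermitian_pinv_mul A).eq, conjTranspose_mul]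
  have h2 : pinv A = pinv A * (pinv A)ᴴ * Aᴴ := by
    conv_lhs =>
      rw [← pinv_mul_self_mul_pinv A, Matrix.mul_assoc, ← (isHermitian_mul_pinv A).eq,
        conjTranspose_mul, ← Matrix.mul_assoc]
  calc pinv A = Aᴴ * (pinv A)ᴴ * pinv A := h1
    _ = Aᴴ * (pinv A)ᴴ * (pinv A * (pinv A)ᴴ * Aᴴ) := by rw [← h2]
    _ = Aᴴ * ((pinv A)ᴴ * pinv A * (pinv A)ᴴ) * Aᴴ := by simp only [Matrix.mul_assoc]

/-- **Ch. 3 Ex. 19**, (b) ⇒ (a): a `{1}`-inverse `X` of `A` (`A X A = A`) lying in `R(A*, A*)`,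
i.e. `X = A* B A*`, is the Moore–Penrose inverse.  This identifies the limit in Theorem 3.
[cite: BenIsraelGreville2003, Ch. 3 Ex. 19; Ch. 7 §7 Thm 3, proof] -/
theorem eq_pinv_of_mul_mul_self_of_eq_conjTranspose_mul (A B : Matrix m n 𝕜) {X : Matrix n m 𝕜}
    (hX : X = Aᴴ * B * Aᴴ) (h₁ : A * X * A = A) : X = pinv A := by
  have hXP : X * (A * pinv A) = X := by
    rw [hX]; exact conjTranspose_mul_mul_conjTranspose_mul_proj A B
  have hQX : pinv A * A * X = X := by
    rw [hX]; exact proj_mul_conjTranspose_mul_mul_conjTranspose A B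
  calc X = pinv A * A * X * (A * pinv A) := by rw [hQX, hXP]
    _ = pinv A * (A * X * A) * pinv A := by simp only [Matrix.mul_assoc]
    _ = pinv A := by rw [h₁, pinv_mul_self_mul_pinv]

variable [DecidableEq m]

/-- The algebra behind **Ex. 18 (92)**: with `P = A A†`, `R₀ = P − A X₀` and `X₀ = A* B A*`,
`A† (I − R₀) = X₀` (since `A† P = A†` and `A† A X₀ = X₀`).
[cite: BenIsraelGreville2003, Ch. 7 Ex. 18 (92)] -/
theorem pinv_mul_one_sub_residual (A B : Matrix m n 𝕜) :
    pinv A * (1 - (A * pinv A - A * (Aᴴ * B * Aᴴ))) = Aᴴ * B * Aᴴ := by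
  rw [Matrix.mul_sub, Matrix.mul_one, Matrix.mul_sub, ← Matrix.mul_assoc (pinv A) A (pinv A),
    pinv_mul_self_mul_pinv, ← Matrix.mul_assoc (pinv A) A,
    proj_mul_conjTranspose_mul_mul_conjTranspose, sub_sub_cancel]

/-- **Ex. 18 (92)**: if `X₀ = A* B A*` and `I − R₀` is nonsingular (`R₀ = A A† − A X₀`; this
holds under (76)), then `A† = X₀ (I − R₀)⁻¹`. [cite: BenIsraelGreville2003, Ch. 7 Ex. 18 (92)] -/
theorem pinv_eq_mul_inv_one_sub_residual (A B : Matrix m n 𝕜) {X₀ : Matrix n m 𝕜}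
    (hX₀ : X₀ = Aᴴ * B * Aᴴ) (h : IsUnit (1 - (A * pinv A - A * X₀))) :
    pinv A = X₀ * (1 - (A * pinv A - A * X₀))⁻¹ := by
  have key := pinv_mul_one_sub_residual A B
  rw [← hX₀] at key
  have hdet : IsUnit (1 - (A * pinv A - A * X₀)).det := (Matrix.isUnit_iff_isUnit_det _).1 h
  calc pinv A = pinv A * ((1 - (A * pinv A - A * X₀)) * (1 - (A * pinv A - A * X₀))⁻¹) := by
        rw [Matrix.mul_nonsing_inv _ hdet, Matrix.mul_one]
    _ = X₀ * (1 - (A * pinv A - A * X₀))⁻¹ := by rw [← Matrix.mul_assoc, key]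

end MoorePenrose

/-! ## Part III — convergence -/

section Convergence

open Literature.LinearAlgebra.Matrix.MoorePenrose

variable {𝕜 : Type*} [RCLike 𝕜] {m n : Type*} [Fintype m] [Fintype n] [DecidableEq m]
  [DecidableEq n]

/-- **Ch. 0 Ex. 46, first half**: a convergent matrix `T` (`T^k → O`, Ex. 45 (63)) has
`I − T` nonsingular. [cite: BenIsraelGreville2003, Ch. 0 Ex. 46 (65)] -/
theorem isUnit_one_sub_of_tendsto_pow {T : Matrix m m 𝕜}
    (hT : Tendsto (fun k : ℕ => T ^ k) atTop (𝓝 0)) : IsUnit (1 - T) := by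
  rw [← Matrix.mulVec_injective_iff_isUnit]
  intro v w hvw
  rw [← sub_eq_zero]
  set d := v - w with hd
  have h0 : (1 - T) *ᵥ d = 0 := by rw [hd, Matrix.mulVec_sub, hvw, sub_self]
  have h1 : T *ᵥ d = d := by
    rw [Matrix.sub_mulVec, Matrix.one_mulVec, sub_eq_zero] at h0
    exact h0.symm
  have h2 : ∀ k : ℕ, T ^ k *ᵥ d = d := by
    intro k
    induction k with
    | zero => rw [pow_zero, Matrix.one_mulVec]
    | succ k ih => rw [pow_succ, ← Matrix.mulVec_mulVec, h1, ih]
  have h3 : Tendsto (fun k : ℕ => T ^ k *ᵥ d) atTop (𝓝 ((0 : Matrix m m 𝕜) *ᵥ d)) :=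
    ((continuous_id.matrix_mulVec continuous_const).tendsto (0 : Matrix m m 𝕜)).comp hT
  rw [Matrix.zero_mulVec] at h3
  exact tendsto_nhds_unique tendsto_const_nhds (h3.congr h2)

/-- **Ch. 0 Ex. 46 (65)**: for a convergent matrix `T`, the partial sums
`I + T + ⋯ + T^{k−1}` converge to `(I − T)⁻¹`.
[cite: BenIsraelGreville2003, Ch. 0 Ex. 46 (65)] -/
theorem tendsto_geom_sum_of_tendsto_pow {T : Matrix m m 𝕜}
    (hT : Tendsto (fun k : ℕ => T ^ k) atTop (𝓝 0)) :
    Tendsto (fun k : ℕ => ∑ j ∈ range k, T ^ j) atTop (𝓝 (1 - T)⁻¹) := by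
  have hdet : IsUnit (1 - T).det :=
    (Matrix.isUnit_iff_isUnit_det _).1 (isUnit_one_sub_of_tendsto_pow hT)
  have hS : ∀ k : ℕ, ∑ j ∈ range k, T ^ j = (1 - T ^ k) * (1 - T)⁻¹ := fun k => by
    rw [← geom_sum_mul_neg, Matrix.mul_assoc, Matrix.mul_nonsing_inv _ hdet, Matrix.mul_one]
  simp_rw [hS]
  have h : Tendsto (fun k : ℕ => (1 - T ^ k) * (1 - T)⁻¹) atTop (𝓝 ((1 - 0) * (1 - T)⁻¹)) :=
    (tendsto_const_nhds.sub hT).mul tendsto_const_nhds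
  rw [sub_zero, Matrix.one_mul] at h
  exact h

/-- **Theorem 3** [Ch. 7 §7]: if `X₀ = A* B A*` (75) and `R₀ = P_{R(A)} − A X₀` is a convergent
matrix (`R₀^k → O`; by Ch. 0 Ex. 45 (63) this is `ρ(R₀) < 1`, i.e. (76)), then the first-order
method (77) converges to `A†`. [cite: BenIsraelGreville2003, Ch. 7 §7 Thm 3 (75)–(77)] -/
theorem firstOrder_tendsto_pinv (A B : Matrix m n 𝕜) (X : ℕ → Matrix n m 𝕜)
    (hX₀ : X 0 = Aᴴ * B * Aᴴ) (hX : ∀ k, X (k + 1) = X k + X 0 * (1 - A * X k))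
    (hR : Tendsto (fun k : ℕ => (A * pinv A - A * X 0) ^ k) atTop (𝓝 0)) :
    Tendsto X atTop (𝓝 (pinv A)) := by
  have hX₀P : X 0 * (A * pinv A) = X 0 := by
    rw [hX₀]; exact conjTranspose_mul_mul_conjTranspose_mul_proj A B
  have hclosed := firstOrder_eq_mul_geom_sum_proj (mul_pinv_idem A) (mul_pinv_mul_self A) hX₀P hX
  rw [pinv_eq_mul_inv_one_sub_residual A B hX₀ (isUnit_one_sub_of_tendsto_pow hR)]
  have hc : Continuous fun S : Matrix m m 𝕜 => X 0 * S := continuous_const.matrix_mul continuous_id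
  have h :=
    (hc.tendsto _).comp ((tendsto_geom_sum_of_tendsto_pow hR).comp (tendsto_add_atTop_nat 1))
  exact h.congr fun k => (hclosed k).symm

/-- **Theorem 3, (82)**: under the same hypotheses the residuals `R_k = P_{R(A)} − A X_k = R₀^{k+1}`
converge to `O`. [cite: BenIsraelGreville2003, Ch. 7 §7 Thm 3 (81)–(82)] -/
theorem firstOrder_residual_tendsto_zero (A B : Matrix m n 𝕜) (X : ℕ → Matrix n m 𝕜)
    (hX₀ : X 0 = Aᴴ * B * Aᴴ) (hX : ∀ k, X (k + 1) = X k + X 0 * (1 - A * X k))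
    (hR : Tendsto (fun k : ℕ => (A * pinv A - A * X 0) ^ k) atTop (𝓝 0)) :
    Tendsto (fun k => A * pinv A - A * X k) atTop (𝓝 0) := by
  have hX₀P : X 0 * (A * pinv A) = X 0 := by
    rw [hX₀]; exact conjTranspose_mul_mul_conjTranspose_mul_proj A B
  have h81 := firstOrder_proj_sub_mul (mul_pinv_idem A) (mul_pinv_mul_self A) hX₀P hX
  exact (hR.comp (tendsto_add_atTop_nat 1)).congr fun k => (h81 k).symm

/-- **Theorem 4** [Ch. 7 §7]: under (75) and "`R₀` convergent" ((76)), the `p`-th order method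
(84), `p ≥ 2`, converges to `A†`. [cite: BenIsraelGreville2003, Ch. 7 §7 Thm 4 (84)] -/
theorem hyperpower_tendsto_pinv (A B : Matrix m n 𝕜) (X : ℕ → Matrix n m 𝕜)
    (hX₀ : X 0 = Aᴴ * B * Aᴴ) {p : ℕ} (hp : 1 < p)
    (hX : ∀ k, X (k + 1) = X k * ∑ i ∈ range p, (1 - A * X k) ^ i)
    (hR : Tendsto (fun k : ℕ => (A * pinv A - A * X 0) ^ k) atTop (𝓝 0)) :
    Tendsto X atTop (𝓝 (pinv A)) := by
  have hX₀P : X 0 * (A * pinv A) = X 0 := by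
    rw [hX₀]; exact conjTranspose_mul_mul_conjTranspose_mul_proj A B
  have hclosed := hyperpower_eq_mul_geom_sum_proj (mul_pinv_idem A) (mul_pinv_mul_self A) hX₀P hX
  rw [pinv_eq_mul_inv_one_sub_residual A B hX₀ (isUnit_one_sub_of_tendsto_pow hR)]
  have hc : Continuous fun S : Matrix m m 𝕜 => X 0 * S := continuous_const.matrix_mul continuous_id
  have h := (hc.tendsto _).comp
    ((tendsto_geom_sum_of_tendsto_pow hR).comp (tendsto_pow_atTop_atTop_of_one_lt hp))
  exact h.congr fun k => (hclosed k).symm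

/-- **Theorem 4, residuals**: `R_k = R₀^{p^k} → O` for the `p`-th order method, `p ≥ 2`.
[cite: BenIsraelGreville2003, Ch. 7 §7 Thm 4 (89)] -/
theorem hyperpower_residual_tendsto_zero (A B : Matrix m n 𝕜) (X : ℕ → Matrix n m 𝕜)
    (hX₀ : X 0 = Aᴴ * B * Aᴴ) {p : ℕ} (hp : 1 < p)
    (hX : ∀ k, X (k + 1) = X k * ∑ i ∈ range p, (1 - A * X k) ^ i)
    (hR : Tendsto (fun k : ℕ => (A * pinv A - A * X 0) ^ k) atTop (𝓝 0)) :
    Tendsto (fun k => A * pinv A - A * X k) atTop (𝓝 0) := by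
  have hX₀P : X 0 * (A * pinv A) = X 0 := by
    rw [hX₀]; exact conjTranspose_mul_mul_conjTranspose_mul_proj A B
  have h89 := hyperpower_proj_sub_mul (mul_pinv_idem A) (mul_pinv_mul_self A) hX₀P
    (zero_lt_one.trans hp) hX
  exact (hR.comp (tendsto_pow_atTop_atTop_of_one_lt hp)).congr fun k => (h89 k).symm

/-- **Ch. 0 Ex. 45 (63)** for complex matrices, in matrix form: `ρ(T) < 1 ⇒ T^k → O`
(entrywise, i.e. in the topology of `Matrix`).
[cite: BenIsraelGreville2003, Ch. 0 Ex. 45 (63)] -/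
theorem tendsto_pow_of_spectralRadius_lt_one_matrix {m : Type*} [Fintype m] [DecidableEq m]
    {T : Matrix m m ℂ} (h : spectralRadius ℂ T < 1) :
    Tendsto (fun k : ℕ => T ^ k) atTop (𝓝 0) :=
  tendsto_pi_nhds.2 fun i => tendsto_pi_nhds.2 fun j => by
    simpa only [Matrix.zero_apply] using tendsto_pow_apply_of_spectralRadius_lt_one h i j

/-- **Theorem 3 verbatim over `ℂ`**: (75) `X₀ = A* B A*` and (76) `ρ(P_{R(A)} − A X₀) < 1` imply
that the first-order method (77) converges to `A†`.
[cite: BenIsraelGreville2003, Ch. 7 §7 Thm 3 (75)–(77)] -/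
theorem firstOrder_tendsto_pinv_of_spectralRadius_lt_one {m n : Type*} [Fintype m] [Fintype n]
    [DecidableEq m] [DecidableEq n] (A B : Matrix m n ℂ) (X : ℕ → Matrix n m ℂ)
    (hX₀ : X 0 = Aᴴ * B * Aᴴ) (hX : ∀ k, X (k + 1) = X k + X 0 * (1 - A * X k))
    (hρ : spectralRadius ℂ (A * pinv A - A * X 0) < 1) : Tendsto X atTop (𝓝 (pinv A)) :=
  firstOrder_tendsto_pinv A B X hX₀ hX (tendsto_pow_of_spectralRadius_lt_one_matrix hρ)

/-- **Theorem 4 verbatim over `ℂ`**: (75), (76) and `p ≥ 2` imply that the `p`-th order method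
(84) converges to `A†`. [cite: BenIsraelGreville2003, Ch. 7 §7 Thm 4 (84)] -/
theorem hyperpower_tendsto_pinv_of_spectralRadius_lt_one {m n : Type*} [Fintype m] [Fintype n]
    [DecidableEq m] [DecidableEq n] (A B : Matrix m n ℂ) (X : ℕ → Matrix n m ℂ)
    (hX₀ : X 0 = Aᴴ * B * Aᴴ) {p : ℕ} (hp : 1 < p)
    (hX : ∀ k, X (k + 1) = X k * ∑ i ∈ range p, (1 - A * X k) ^ i)
    (hρ : spectralRadius ℂ (A * pinv A - A * X 0) < 1) : Tendsto X atTop (𝓝 (pinv A)) :=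
  hyperpower_tendsto_pinv A B X hX₀ hp hX (tendsto_pow_of_spectralRadius_lt_one_matrix hρ)

end Convergence

/-! ## Part IV — Ex. 17: condition (75) cannot be dropped -/

section Example17

open Literature.LinearAlgebra.Matrix.MoorePenrose

/-- Ex. 17: `A = ½[1 1; 1 1]` is its own Moore–Penrose inverse.
[cite: BenIsraelGreville2003, Ch. 7 Ex. 17] -/
theorem ex17_pinv_eq {A : Matrix (Fin 2) (Fin 2) ℝ} (hA : A = !![2⁻¹, 2⁻¹; 2⁻¹, 2⁻¹]) :
    pinv A = A := by
  have hAA : A * A = A := by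
    subst hA; ext i j; fin_cases i <;> fin_cases j <;> norm_num [Matrix.mul_apply, Fin.sum_univ_two]
  have hH : A.IsHermitian := by
    subst hA; ext i j; fin_cases i <;> fin_cases j <;> simp [Matrix.conjTranspose_apply]
  have hAH : (A * A).IsHermitian := by rw [hAA]; exact hH
  exact (isMoorePenroseInverse_iff_eq_pinv.1 ⟨by rw [hAA, hAA], by rw [hAA, hAA], hAH, hAH⟩).symm

/-- Ex. 17: with `B = ε[1 −1; −1 1]`, `A B = O = B A` and `A² = A`.
[cite: BenIsraelGreville2003, Ch. 7 Ex. 17] -/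
theorem ex17_mul {A B : Matrix (Fin 2) (Fin 2) ℝ} {ε : ℝ} (hA : A = !![2⁻¹, 2⁻¹; 2⁻¹, 2⁻¹])
    (hB : B = !![ε, -ε; -ε, ε]) : A * A = A ∧ A * B = 0 ∧ B * A = 0 := by
  subst hA hB
  refine ⟨?_, ?_, ?_⟩ <;> ext i j <;> fin_cases i <;> fin_cases j <;>
    norm_num [Matrix.mul_apply, Fin.sum_univ_two]

/-- Ex. 17: for `X₀ = A + B` the residual `R₀ = P_{R(A)} − A X₀` vanishes, so (76) holds
(`ρ(R₀) = 0 < 1`, `R₀` is trivially convergent). [cite: BenIsraelGreville2003, Ch. 7 Ex. 17] -/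
theorem ex17_residual_eq_zero {A B : Matrix (Fin 2) (Fin 2) ℝ} {ε : ℝ}
    (hA : A = !![2⁻¹, 2⁻¹; 2⁻¹, 2⁻¹]) (hB : B = !![ε, -ε; -ε, ε]) :
    A * pinv A - A * (A + B) = 0 := by
  obtain ⟨hAA, hAB, -⟩ := ex17_mul hA hB
  rw [ex17_pinv_eq hA, Matrix.mul_add, hAA, hAB, add_zero, sub_self]

/-- Ex. 17: but (75) fails — `X₀ P_{R(A)} = A ≠ X₀` for `ε ≠ 0`, so `X₀ ∉ R(A*, A*)` (every
`A* Y A*` satisfies `X P_{R(A)} = X`, `conjTranspose_mul_mul_conjTranspose_mul_proj`).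
[cite: BenIsraelGreville2003, Ch. 7 Ex. 17] -/
theorem ex17_mul_proj_ne {A B : Matrix (Fin 2) (Fin 2) ℝ} {ε : ℝ} (hε : ε ≠ 0)
    (hA : A = !![2⁻¹, 2⁻¹; 2⁻¹, 2⁻¹]) (hB : B = !![ε, -ε; -ε, ε]) :
    (A + B) * (A * pinv A) = A ∧ (A + B) * (A * pinv A) ≠ A + B := by
  obtain ⟨hAA, -, hBA⟩ := ex17_mul hA hB
  have h : (A + B) * (A * pinv A) = A := by
    rw [ex17_pinv_eq hA, hAA, Matrix.add_mul, hAA, hBA, add_zero]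
  refine ⟨h, fun h' => hε ?_⟩
  have hB0 : B = 0 := by
    have := h.symm.trans h'
    simpa using this
  have := congrFun (congrFun hB0 0) 0
  simpa [hB] using this

/-- Ex. 17, residual form: the iterates of (80) (equivalently of (87), since `R_k = O` throughout)
started at `X₀ = A + B` are constant, `X_k = X₀`, and `X₀ ≠ A†` when `ε ≠ 0` — the method does
not converge to `A†` although (76) holds. [cite: BenIsraelGreville2003, Ch. 7 Ex. 17] -/
theorem ex17_residualForm_const {A B : Matrix (Fin 2) (Fin 2) ℝ} {ε : ℝ} (hε : ε ≠ 0)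
    (hA : A = !![2⁻¹, 2⁻¹; 2⁻¹, 2⁻¹]) (hB : B = !![ε, -ε; -ε, ε]) (X : ℕ → Matrix (Fin 2) (Fin 2) ℝ)
    (hX0 : X 0 = A + B) (hX : ∀ k, X (k + 1) = X k + X 0 * (A * pinv A - A * X k)) (k : ℕ) :
    X k = A + B ∧ X k ≠ pinv A := by
  have hconst : ∀ k, X k = A + B := by
    intro k
    induction k with
    | zero => exact hX0
    | succ k ih => rw [hX, ih, hX0, ex17_residual_eq_zero hA hB, Matrix.mul_zero, add_zero]
  refine ⟨hconst k, fun h => hε ?_⟩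
  rw [hconst k, ex17_pinv_eq hA, add_eq_left] at h
  have := congrFun (congrFun h 0) 0
  simpa [hB] using this

/-- Ex. 17, `T`-form of (77): started at `X₀ = A + B` the first-order iterates are
`X_k = A + (k+1) B`, which for `ε ≠ 0` never equal `A† = A` (and are unbounded).
[cite: BenIsraelGreville2003, Ch. 7 Ex. 17 with (77)] -/
theorem ex17_firstOrder {A B : Matrix (Fin 2) (Fin 2) ℝ} {ε : ℝ}
    (hA : A = !![2⁻¹, 2⁻¹; 2⁻¹, 2⁻¹]) (hB : B = !![ε, -ε; -ε, ε]) (X : ℕ → Matrix (Fin 2) (Fin 2) ℝ)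
    (hX0 : X 0 = A + B) (hX : ∀ k, X (k + 1) = X k + X 0 * (1 - A * X k)) (k : ℕ) :
    X k = A + ((k : ℝ) + 1) • B := by
  obtain ⟨hAA, hAB, hBA⟩ := ex17_mul hA hB
  induction k with
  | zero => rw [hX0, Nat.cast_zero, zero_add, one_smul]
  | succ k ih =>
    have hAX : A * (A + ((k : ℝ) + 1) • B) = A := by
      rw [Matrix.mul_add, Matrix.mul_smul, hAA, hAB, smul_zero, add_zero]
    have hX0T : (A + B) * (1 - A) = B := by
      rw [Matrix.mul_sub, Matrix.mul_one, Matrix.add_mul, hAA, hBA, add_zero, add_sub_cancel_left]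
    rw [hX, ih, hX0, hAX, hX0T, Nat.cast_succ]
    simp only [add_smul, one_smul, add_assoc]

/-- Ex. 17, `T`-form of the Schulz iteration (101) (`p = 2` in (84)): started at `X₀ = A + B`
the iterates are `X_k = A + 2^k B` — again not convergent to `A† = A` for `ε ≠ 0`.
[cite: BenIsraelGreville2003, Ch. 7 Ex. 17 with (84), Ex. 22 (101)] -/
theorem ex17_schulz {A B : Matrix (Fin 2) (Fin 2) ℝ} {ε : ℝ}
    (hA : A = !![2⁻¹, 2⁻¹; 2⁻¹, 2⁻¹]) (hB : B = !![ε, -ε; -ε, ε]) (X : ℕ → Matrix (Fin 2) (Fin 2) ℝ)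
    (hX0 : X 0 = A + B) (hX : ∀ k, X (k + 1) = X k * (2 - A * X k)) (k : ℕ) :
    X k = A + (2 ^ k : ℝ) • B := by
  obtain ⟨hAA, hAB, hBA⟩ := ex17_mul hA hB
  induction k with
  | zero => rw [hX0, pow_zero, one_smul]
  | succ k ih =>
    have hAX : A * (A + (2 ^ k : ℝ) • B) = A := by
      rw [Matrix.mul_add, Matrix.mul_smul, hAA, hAB, smul_zero, add_zero]
    rw [hX, ih, hAX, Matrix.mul_sub, mul_two, Matrix.add_mul, Matrix.smul_mul, hAA, hBA, smul_zero,
      add_zero, pow_succ, mul_smul, two_smul, smul_add]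
    abel

/-- Ex. 17, conclusion: for `ε ≠ 0` none of these iterates is `A†`.
[cite: BenIsraelGreville2003, Ch. 7 Ex. 17] -/
theorem ex17_ne_pinv {A B : Matrix (Fin 2) (Fin 2) ℝ} {ε : ℝ} (hε : ε ≠ 0)
    (hA : A = !![2⁻¹, 2⁻¹; 2⁻¹, 2⁻¹]) (hB : B = !![ε, -ε; -ε, ε]) {c : ℝ} (hc : c ≠ 0) :
    A + c • B ≠ pinv A := by
  intro h
  rw [ex17_pinv_eq hA, add_eq_left] at h
  have := congrFun (congrFun h 0) 0
  simp [hB, hc, hε] at this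

end Example17

end Literature.LinearAlgebra.Matrix.HyperpowerIteration
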